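import Summits.CriticalPhenomena.PercolationContinuityZ3.Theorems.PercNearOneGluingNoHeavyPcintNawMemZ6M10Defs
import HarnessLib

/-!
# PCINT lane, kernel reduced-state B2r certificate `Z6M10` (d = 6, memory τ = 10, 798 state classes): row checks 3 (rows [480, 720))

Cell `prim-pcint`, seat `prim-pcint-1` (gen 5); memo `run/shared/lean/prim/pcint/INTERVAL-PLAN.md` §16 ("checker for the reduced-state
automata").  Does NOT build on p205010.  Data for `NawK.le_siteCriticalProb_of_checkRows` (`…PcintNawRandMemKernelCert`): `p = 10060/100000`,
`q̄ = 99041/100000` (`q̄^11·100000^11 ≥ (100000-10060)·100000^10`), `κ̄ = (100000+99041)/(2·100000)`, `λ = 99999/100000`; Collatz–Wielandt weights (scale 10⁹) from a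
power iteration, exact off-line max row ratio 0.9996917089 < λ.  Generated by gen5/gen_lean.py (pcint-1 folder); the kernel re-checks every row.
-/

namespace Summit.CriticalPhenomena.PercolationContinuityZ3.Theorems.Pcint.NawMemZ6M10

set_option maxHeartbeats 0 in
/-- Rows `[480, 560)` pass the check. [folklore] -/
theorem chk_480 : WinK.allRange chk 480 560 = true :=
  WinK.allRange_of_allRangeB (fuel := 8) (lo := 480) (len := 80) (by decide +kernel)

set_option maxHeartbeats 0 in
/-- Rows `[560, 640)` pass the check. [folklore] -/
theorem chk_560 : WinK.allRange chk 560 640 = true :=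
  WinK.allRange_of_allRangeB (fuel := 8) (lo := 560) (len := 80) (by decide +kernel)

set_option maxHeartbeats 0 in
/-- Rows `[640, 720)` pass the check. [folklore] -/
theorem chk_640 : WinK.allRange chk 640 720 = true :=
  WinK.allRange_of_allRangeB (fuel := 8) (lo := 640) (len := 80) (by decide +kernel)

/-- Rows `[480, 720)` pass the check. [folklore] -/
theorem file_3 : WinK.allRange chk 480 720 = true := (WinK.allRange_split (WinK.allRange_split chk_480 chk_560) chk_640)

end Summit.CriticalPhenomena.PercolationContinuityZ3.Theorems.Pcint.NawMemZ6M10
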